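import Summits.CriticalPhenomena.PercolationContinuityZ3.Theorems.SahiMasterFamilyFInequalityComponentReduction

/-!
# The strengthened Kleitman conjecture (KC), the abstract twisted Marica–Schönheim conjecture (AMS), and the chain
# `(AMS) ⟹ (KC) ⟹ WF_comb ≥ 0 whenever G ⊆ A ∪ B`;  also `(KC2) ⟹ (KC)`

Support file for the master-family `F`-inequality programme (`prim-master-conj` gen 25; `--supports stmt-CriticalPhenomena-4575`;
memo `run/shared/lean/prim/prim-l12/prim-master-conj/POINTWISE.md` §26.7).  No `sorry`, standard axioms.  Builds on
`SahiMasterFamilyFInequalityComponentReduction` (`SameComp`, `ccWeight`, `upHull`, `KC2Weighted`).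

Definitions (conjectures stated as `Prop`s; both OPEN, computer-verified as recorded in the docstrings):
* `KCWeighted ω` — (KC): for upper families `V ⊆ Y`, `ccWeight ω (Y∖V) ≤ 2·Σ_{v ∈ V, vᶜ ∉ Y} ω v`
  ("coherent antipodal pairs outweigh cross-component antipodal pairs of `Y∖V`").  With two components this is Kleitman's lemma.
* `AMSWeighted ω` — (AMS): for every complement-closed family `S` and every equivalence relation `R` on points with `¬ R x xᶜ` (x ∈ S):
  `Σ_{x∈S} ω x ≤ 2·Σ_{u ∈ J} ω u`, `J = {x ∪ z : x,z ∈ S, ¬R x z, ¬R xᶜ zᶜ}`.  For two classes and `ω ≡ 1` this is the Marica–Schönheim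
  inequality `|A ∖∖ A| ≥ |A|`; the new content is the case of a non-bipartite "class graph".

Theorems:
* `KCWeighted_of_KC2Weighted` — (KC2) ⟹ (KC).
* `union_mem_of_not_sameComp`, `inter_not_mem_of_not_sameComp` — for `x, z ∈ Y∖V` in different comparability components, `x ∪ z ∈ V` and `x ∩ z ∉ Y`.
* `KCWeighted_of_AMSWeighted` — (AMS) ⟹ (KC) (for `ω ≥ 0`): apply (AMS) to the cross-component points with `R = SameComp (Y∖V)`.
* `weightedFcomb_nonneg_of_KC_of_subset_union` — (KC) ⟹ `WF(ω;A,B,G) ≥ 0` for upper `A, B, G` with `G ⊆ A ∪ B` and complement-invariant `ω ≥ 0`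
  (via the κ-decomposition with `W = A ∩ B` and (KC) applied to `(A∩B∩G, (A∩B) ∪ G)`).

HONEST FRAMING: reductions between OPEN conjectures and the target; `F ≥ 0` remains open. [this work]
-/

namespace Summit.CriticalPhenomena.PercolationContinuityZ3.Theorems

namespace TwistedAD

open Finset
open scoped FinsetFamily Classical

variable {κ : Type*} [Fintype κ] [DecidableEq κ]

/-- **CONJECTURE (KC), weighted form** (POINTWISE §26; STATUS: open; `ω ≡ 1` verified for all 57,471,561 pairs of up-sets of `{0,1}^5`, samples in
`{0,1}^6`, `{0,1}^7`).  For upper families `V ⊆ Y`: `ccWeight ω (Y ∖ V) ≤ 2 · Σ_{v ∈ V ∖ Yᶜˢ} ω v` (`v ∈ V ∖ Yᶜˢ ⟺ v ∈ V ∧ vᶜ ∉ Y`). [this work] -/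
def KCWeighted (ω : Finset κ → ℝ) : Prop :=
  ∀ V Y : Finset (Finset κ), IsUpperSet (V : Set (Finset κ)) → IsUpperSet (Y : Set (Finset κ)) → V ⊆ Y →
    ccWeight ω (Y \ V) ≤ 2 * ∑ s ∈ V \ Yᶜˢ, ω s

/-- **CONJECTURE (AMS), weighted form — "abstract twisted Marica–Schönheim"** (POINTWISE §26.7; STATUS: open; `ω ≡ 1` verified for every
complement-closed `S ⊆ 2^[4]` with every labelling by ≤ 3 classes and `|S| ≤ 12` with 4 classes (10⁸ cases), all of `2^[3]`, and 3.5·10⁶ random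
cases in dimensions 5–7; the FKG-weighted form on 10⁶ random Ising-weighted cases).  For every complement-closed family `S` and every equivalence
relation `R` with `¬ R x xᶜ` on `S`:  `Σ_{x ∈ S} ω x ≤ 2 · Σ_{u ∈ J} ω u`,  `J = {x ∪ z : x, z ∈ S, ¬R x z, ¬R xᶜ zᶜ}`. [this work] -/
def AMSWeighted (ω : Finset κ → ℝ) : Prop :=
  ∀ (S : Finset (Finset κ)) (R : Finset κ → Finset κ → Prop), Equivalence R → (∀ x ∈ S, xᶜ ∈ S) → (∀ x ∈ S, ¬ R x xᶜ) →
    ∑ x ∈ S, ω x ≤ 2 * ∑ u ∈ ((S ×ˢ S).filter (fun p => ¬ R p.1 p.2 ∧ ¬ R p.1ᶜ p.2ᶜ)).image (fun p => p.1 ∪ p.2), ω u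

/-! ### (KC2) ⟹ (KC) -/

/-- (KC2) implies (KC): take `E = G = Y` in `KC2Weighted` and use `V ⊆ upHull V Y`. [this work] -/
theorem KCWeighted_of_KC2Weighted (ω : Finset κ → ℝ) (hω₀ : ∀ s, 0 ≤ ω s) (h : KC2Weighted ω) : KCWeighted ω := by
  intro V Y hV hY hVY
  have key := h V Y Y hV hY hY hVY le_rfl
  have hsub : V ∩ Yᶜˢ ⊆ upHull V Y ∩ Yᶜˢ :=
    inter_subset_inter (subset_upHull_of_upper V Y V hV (inter_subset_left.trans le_rfl)) le_rfl
  have h1 : ∑ s ∈ V ∩ Yᶜˢ, ω s ≤ ∑ s ∈ upHull V Y ∩ Yᶜˢ, ω s :=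
    sum_le_sum_of_subset_of_nonneg hsub fun s _ _ => hω₀ s
  have h2 : ∑ s ∈ V ∩ (Y \ Y)ᶜˢ, ω s = 0 := by
    rw [sdiff_self, Finset.bot_eq_empty, compls_empty, inter_empty, sum_empty]
  have h3 : ∑ s ∈ V, ω s = ∑ s ∈ V \ Yᶜˢ, ω s + ∑ s ∈ V ∩ Yᶜˢ, ω s := by
    rw [← sum_union (disjoint_sdiff_inter V Yᶜˢ), sdiff_union_inter]
  rw [h2] at key
  linarith

/-! ### Points in different comparability components: union in `V`, intersection outside `Y` -/

omit [Fintype κ] in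
/-- If `x, z ∈ Y ∖ V` (`Y` upper) lie in different comparability components of `Y ∖ V`, then `x ∪ z ∈ V`. [this work] -/
theorem union_mem_of_not_sameComp (V Y : Finset (Finset κ)) (hY : IsUpperSet (Y : Set (Finset κ)))
    {x z : Finset κ} (hx : x ∈ Y \ V) (hz : z ∈ Y \ V) (h : ¬ SameComp (Y \ V) x z) : x ∪ z ∈ V := by
  by_contra hnot
  have hxY : x ∈ Y := (mem_sdiff.1 hx).1
  have hu : x ∪ z ∈ Y \ V := mem_sdiff.2 ⟨hY (subset_union_left : x ⊆ x ∪ z) hxY, hnot⟩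
  apply h
  have h1 : SameComp (Y \ V) x (x ∪ z) := Relation.EqvGen.rel _ _ ⟨hx, hu, Or.inl subset_union_left⟩
  have h2 : SameComp (Y \ V) z (x ∪ z) := Relation.EqvGen.rel _ _ ⟨hz, hu, Or.inl subset_union_right⟩
  exact h1.trans _ _ _ (h2.symm _ _)

omit [Fintype κ] in
/-- If `x, z ∈ Y ∖ V` (upper `V ⊆ Y`) lie in different comparability components of `Y ∖ V`, then `x ∩ z ∉ Y`. [this work] -/
theorem inter_not_mem_of_not_sameComp (V Y : Finset (Finset κ)) (hV : IsUpperSet (V : Set (Finset κ)))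
    {x z : Finset κ} (hx : x ∈ Y \ V) (hz : z ∈ Y \ V) (h : ¬ SameComp (Y \ V) x z) : x ∩ z ∉ Y := by
  intro hiY
  have hxV : x ∉ V := (mem_sdiff.1 hx).2
  have hiV : x ∩ z ∉ V := fun hi => hxV (hV (inter_subset_left : x ∩ z ⊆ x) hi)
  have hi : x ∩ z ∈ Y \ V := mem_sdiff.2 ⟨hiY, hiV⟩
  apply h
  have h1 : SameComp (Y \ V) (x ∩ z) x := Relation.EqvGen.rel _ _ ⟨hi, hx, Or.inl inter_subset_left⟩
  have h2 : SameComp (Y \ V) (x ∩ z) z := Relation.EqvGen.rel _ _ ⟨hi, hz, Or.inl inter_subset_right⟩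
  exact (h1.symm _ _).trans _ _ _ h2

/-! ### (AMS) ⟹ (KC) -/

/-- **(AMS) implies (KC).**  Apply (AMS) to `S = {x ∈ Y∖V : xᶜ ∈ Y∖V, ¬SameComp (Y∖V) x xᶜ}` with `R = SameComp (Y∖V)`: every admissible union
`x ∪ z` lies in `V` with `(x ∪ z)ᶜ = xᶜ ∩ zᶜ ∉ Y`, so the `J`-sum is dominated by `Σ_{V ∖ Yᶜˢ} ω`, and `Σ_S ω = ccWeight ω (Y∖V)`. [this work] -/
theorem KCWeighted_of_AMSWeighted (ω : Finset κ → ℝ) (hω₀ : ∀ s, 0 ≤ ω s) (h : AMSWeighted ω) : KCWeighted ω := by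
  intro V Y hV hY hVY
  set T : Finset (Finset κ) := Y \ V with hT
  set S : Finset (Finset κ) := T.filter (fun x => xᶜ ∈ T ∧ ¬ SameComp T x xᶜ) with hS
  have hequiv : Equivalence (SameComp T) := Relation.EqvGen.is_equivalence _
  have hScl : ∀ x ∈ S, xᶜ ∈ S := by
    intro x hx
    rw [hS, mem_filter] at hx ⊢
    obtain ⟨hxT, hxcT, hns⟩ := hx
    refine ⟨hxcT, ?_, ?_⟩
    · rw [compl_compl]; exact hxT
    · rw [compl_compl]; exact fun hsame => hns (hequiv.symm hsame)
  have hSnot : ∀ x ∈ S, ¬ SameComp T x xᶜ := fun x hx => ((mem_filter.1 hx).2).2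
  have key := h S (SameComp T) hequiv hScl hSnot
  -- Σ_S ω = ccWeight ω T
  have hccw : ccWeight ω T = ∑ x ∈ S, ω x := by
    unfold ccWeight; rw [hS, sum_filter]
  -- the admissible unions are coherent points
  set J : Finset (Finset κ) := ((S ×ˢ S).filter (fun p => ¬ SameComp T p.1 p.2 ∧ ¬ SameComp T p.1ᶜ p.2ᶜ)).image
      (fun p => p.1 ∪ p.2) with hJ
  have hJsub : J ⊆ V \ Yᶜˢ := by
    intro u hu
    rw [hJ, mem_image] at hu
    obtain ⟨p, hp, rfl⟩ := hu
    rw [mem_filter, mem_product] at hp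
    obtain ⟨⟨hp1, hp2⟩, hn12, hnc12⟩ := hp
    have hp1T : p.1 ∈ T := (mem_filter.1 hp1).1
    have hp2T : p.2 ∈ T := (mem_filter.1 hp2).1
    have hp1cT : p.1ᶜ ∈ T := ((mem_filter.1 hp1).2).1
    have hp2cT : p.2ᶜ ∈ T := ((mem_filter.1 hp2).2).1
    rw [mem_sdiff, mem_compls, Finset.compl_union]
    refine ⟨union_mem_of_not_sameComp V Y hY hp1T hp2T hn12, ?_⟩
    exact inter_not_mem_of_not_sameComp V Y hV hp1cT hp2cT hnc12
  have hJle : ∑ u ∈ J, ω u ≤ ∑ s ∈ V \ Yᶜˢ, ω s := sum_le_sum_of_subset_of_nonneg hJsub fun s _ _ => hω₀ s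
  rw [hccw]
  linarith

/-! ### (KC) ⟹ WF_comb ≥ 0 on the class `G ⊆ A ∪ B` -/

omit [Fintype κ] in
/-- Components do not cross an incomparable splitting: if `D' = P ∪ Q'` and no point of `P` is comparable with a point of `Q'`, then
`SameComp D' x y` with `x ∈ Q'` forces `y ∈ Q'` and `SameComp Q' x y`. [this work] -/
theorem sameComp_restrict (P Q' : Finset (Finset κ))
    (hnc : ∀ a ∈ P, ∀ b ∈ Q', ¬ (a ⊆ b ∨ b ⊆ a)) {x y : Finset κ} (h : SameComp (P ∪ Q') x y) :
    (x ∈ Q' ↔ y ∈ Q') ∧ (x ∈ Q' → SameComp Q' x y) := by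
  induction h with
  | rel a b hab =>
      obtain ⟨ha, hb, hcomp⟩ := hab
      have step : ∀ {a b : Finset κ}, a ∈ P ∪ Q' → b ∈ P ∪ Q' → (a ⊆ b ∨ b ⊆ a) → a ∈ Q' → b ∈ Q' := by
        intro a b _ hb hcomp haQ
        rcases mem_union.1 hb with hbP | hbQ
        · exact absurd (hcomp.symm) (hnc b hbP a haQ)
        · exact hbQ
      have hab' : a ∈ Q' ↔ b ∈ Q' := ⟨step ha hb hcomp, step hb ha hcomp.symm⟩
      refine ⟨hab', fun haQ => Relation.EqvGen.rel _ _ ⟨haQ, hab'.1 haQ, hcomp⟩⟩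
  | refl a => exact ⟨Iff.rfl, fun _ => Relation.EqvGen.refl _⟩
  | symm a b _ ih => exact ⟨ih.1.symm, fun hb => (ih.2 (ih.1.2 hb)).symm _ _⟩
  | trans a b c _ _ ih1 ih2 => exact ⟨ih1.1.trans ih2.1, fun ha => (ih1.2 ha).trans _ _ _ (ih2.2 (ih1.1.1 ha))⟩

/-- The pointwise identity behind `kappa_eq_coherent_sub`: with `w = 𝟙_W(s)`, `g = 𝟙_G(s)`, primes for `sᶜ`:
`wg − w·g′ + w(1−g)·g′(1−w′) = wg·(1−w′)(1−g′) + [wg·w′(1−g′) − w(1−g)·w′g′]`. [this work] -/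
private theorem pointwise_kappa_coherent (W G : Finset (Finset κ)) (s : Finset κ) :
    ((if s ∈ W ∩ G then (1 : ℝ) else 0) - (if s ∈ W then (1 : ℝ) else 0) * (if sᶜ ∈ G then 1 else 0)
        + (if s ∈ W \ G then (1 : ℝ) else 0) * (if sᶜ ∈ G \ W then 1 else 0))
      = (if s ∈ W ∩ G then (1 : ℝ) else 0) * (if sᶜ ∈ (W ∪ G)ᶜ then 1 else 0)
        + ((if s ∈ W ∩ G then (1 : ℝ) else 0) * (if sᶜ ∈ W \ G then 1 else 0)
            - (if s ∈ W \ G then (1 : ℝ) else 0) * (if sᶜ ∈ W ∩ G then 1 else 0)) := by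
  by_cases hw : s ∈ W <;> by_cases hg : s ∈ G <;> by_cases hw' : sᶜ ∈ W <;> by_cases hg' : sᶜ ∈ G <;>
    simp [hw, hg, hw', hg', mem_inter, mem_sdiff, mem_compl]

/-- `κ_ω(W,G)` versus coherent pairs of `(W∩G, W∪G)`: for a complement-invariant `ω` and any families `W, G`,
`ω(W ∩ G) − ω(W ∩ Gᶜˢ) = ω((W∩G) ∖ (W ∪ G)ᶜˢ) − ω((W ∖ G) ∩ (G ∖ W)ᶜˢ)`. [this work] -/
theorem kappa_eq_coherent_sub (ω : Finset κ → ℝ) (hsym : ∀ s, ω sᶜ = ω s) (W G : Finset (Finset κ)) :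
    (∑ s ∈ W ∩ G, ω s) - ∑ s ∈ W ∩ Gᶜˢ, ω s
      = (∑ s ∈ (W ∩ G) \ (W ∪ G)ᶜˢ, ω s) - ∑ s ∈ (W \ G) ∩ (G \ W)ᶜˢ, ω s := by
  have e1 : ∑ s ∈ W ∩ G, ω s = ∑ s, ω s * (if s ∈ W ∩ G then (1 : ℝ) else 0) := (sum_mul_ite_eq ω (W ∩ G)).symm
  have e2 : ∑ s ∈ W ∩ Gᶜˢ, ω s = ∑ s, ω s * ((if s ∈ W then (1 : ℝ) else 0) * (if sᶜ ∈ G then (1 : ℝ) else 0)) :=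
    (sum_mul_ite_ite_compl_eq ω W G).symm
  have e3 : ∑ s ∈ (W \ G) ∩ (G \ W)ᶜˢ, ω s
      = ∑ s, ω s * ((if s ∈ W \ G then (1 : ℝ) else 0) * (if sᶜ ∈ G \ W then (1 : ℝ) else 0)) :=
    (sum_mul_ite_ite_compl_eq ω (W \ G) (G \ W)).symm
  have e4 : ∑ s ∈ (W ∩ G) \ (W ∪ G)ᶜˢ, ω s
      = ∑ s, ω s * ((if s ∈ W ∩ G then (1 : ℝ) else 0) * (if sᶜ ∈ (W ∪ G)ᶜ then (1 : ℝ) else 0)) := by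
    rw [sum_mul_ite_ite_compl_eq ω (W ∩ G) (W ∪ G)ᶜ]
    congr 1
    ext s
    simp only [mem_sdiff, mem_inter, mem_compls, mem_compl]
  have hanti : ∑ s, ω s * ((if s ∈ W ∩ G then (1 : ℝ) else 0) * (if sᶜ ∈ W \ G then (1 : ℝ) else 0))
      = ∑ s, ω s * ((if s ∈ W \ G then (1 : ℝ) else 0) * (if sᶜ ∈ W ∩ G then (1 : ℝ) else 0)) :=
    sum_mul_ite_ite_compl_swap ω hsym (W ∩ G) (W \ G)
  have hP : ∑ s, ω s * (if s ∈ W ∩ G then (1 : ℝ) else 0)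
        - ∑ s, ω s * ((if s ∈ W then (1 : ℝ) else 0) * (if sᶜ ∈ G then (1 : ℝ) else 0))
        + ∑ s, ω s * ((if s ∈ W \ G then (1 : ℝ) else 0) * (if sᶜ ∈ G \ W then (1 : ℝ) else 0))
      = ∑ s, ω s * ((if s ∈ W ∩ G then (1 : ℝ) else 0) * (if sᶜ ∈ (W ∪ G)ᶜ then (1 : ℝ) else 0))
        + (∑ s, ω s * ((if s ∈ W ∩ G then (1 : ℝ) else 0) * (if sᶜ ∈ W \ G then (1 : ℝ) else 0))
            - ∑ s, ω s * ((if s ∈ W \ G then (1 : ℝ) else 0) * (if sᶜ ∈ W ∩ G then (1 : ℝ) else 0))) := by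
    rw [← sum_sub_distrib, ← sum_add_distrib, ← sum_sub_distrib, ← sum_add_distrib]
    refine sum_congr rfl fun s _ => ?_
    rw [← mul_sub, ← mul_add, ← mul_sub, ← mul_add, pointwise_kappa_coherent W G s]
  rw [e1, e2, e3, e4]
  linarith [hP, hanti]

/-- **(KC) ⟹ `WF_comb ≥ 0` on the class `G ⊆ A ∪ B`.**  Let `ω ≥ 0` be complement-invariant and assume `KCWeighted ω`.  Then for upper
families `A, B, G` with `G ⊆ A ∪ B`:
`0 ≤ Σ_s ω s·[𝟙_{A∩B∩G}(s) − 𝟙_{A∩G}(s)𝟙_{B∩G}(sᶜ) − 𝟙_G(s)𝟙_{(A∩B)∖G}(sᶜ)]`.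
Proof: with `W = A ∩ B`, `V = W ∩ G`, `Y = W ∪ G` (upper, `Y ∖ V = (W∖G) ⊔ (G∖W)` with no comparabilities across), the κ-decomposition and
`kappa_eq_coherent_sub` give `WF = ω(V ∖ Yᶜˢ) − ω(X₁) − ω(X₂) + (≥ 0)` where `X₁ = (W∖G) ∩ (G∖W)ᶜˢ` and `X₂` are the crossing points of
`(A∩G, B∩G)`; both `X₁ ⊔ X₁ᶜˢ` and `X₂ ⊔ X₂ᶜˢ` consist of cross-component antipodal points of `Y∖V` (for `X₂` by `mem_sdiff_iff_of_sameComp` inside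
`G∖V`, transported by `sameComp_restrict`), so `2ω(X₁) + 2ω(X₂) ≤ ccWeight ω (Y∖V) ≤ 2ω(V∖Yᶜˢ)` by (KC).  CONDITIONAL on (KC). [this work] -/
theorem weightedFcomb_nonneg_of_KC_of_subset_union (ω : Finset κ → ℝ) (hω₀ : ∀ s, 0 ≤ ω s) (hsym : ∀ s, ω sᶜ = ω s)
    (hKC : KCWeighted ω)
    (A B G : Finset (Finset κ)) (hA : IsUpperSet (A : Set (Finset κ))) (hB : IsUpperSet (B : Set (Finset κ)))
    (hG : IsUpperSet (G : Set (Finset κ))) (hGAB : G ⊆ A ∪ B) :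
    0 ≤ ∑ s, ω s * ((if s ∈ A ∩ B ∩ G then (1 : ℝ) else 0) - (if s ∈ A ∩ G then (1 : ℝ) else 0) * (if sᶜ ∈ B ∩ G then 1 else 0)
              - (if s ∈ G then (1 : ℝ) else 0) * (if sᶜ ∈ (A ∩ B) \ G then 1 else 0)) := by
  rw [weightedFcomb_eq_kappa_decomposition ω hsym A B G]
  set W : Finset (Finset κ) := A ∩ B with hW
  set V : Finset (Finset κ) := W ∩ G with hV
  set Y : Finset (Finset κ) := W ∪ G with hY
  have hWup : IsUpperSet (W : Set (Finset κ)) := by rw [hW, coe_inter]; exact hA.inter hB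
  have hVup : IsUpperSet (V : Set (Finset κ)) := by rw [hV, coe_inter]; exact hWup.inter hG
  have hYup : IsUpperSet (Y : Set (Finset κ)) := by rw [hY, coe_union]; exact hWup.union hG
  have hVY : V ⊆ Y := fun s hs => mem_union.2 (Or.inl (mem_inter.1 hs).1)
  have hKCi := hKC V Y hVup hYup hVY
  -- rewrite κ
  have hkap := kappa_eq_coherent_sub ω hsym W G
  -- the decomposition Y \ V = (W \ G) ∪ (G \ W), with no comparabilities across
  have hsplit : Y \ V = (W \ G) ∪ (G \ W) := by
    ext s
    simp only [hY, hV, mem_sdiff, mem_union, mem_inter, not_and]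
    tauto
  have hnc : ∀ a ∈ W \ G, ∀ b ∈ G \ W, ¬ (a ⊆ b ∨ b ⊆ a) := by
    intro a ha b hb hab
    rw [mem_sdiff] at ha hb
    rcases hab with hab | hba
    · exact hb.2 (hWup hab ha.1)
    · exact ha.2 (hG hba hb.1)
  -- X₁ points are cross-component in Y \ V
  have hX1 : ∀ s ∈ (W \ G) ∩ (G \ W)ᶜˢ, s ∈ Y \ V ∧ sᶜ ∈ Y \ V ∧ ¬ SameComp (Y \ V) s sᶜ := by
    intro s hs
    rw [mem_inter, mem_compls] at hs
    refine ⟨by rw [hsplit]; exact mem_union.2 (Or.inl hs.1), by rw [hsplit]; exact mem_union.2 (Or.inr hs.2), ?_⟩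
    intro hsame
    rw [hsplit] at hsame
    have := (sameComp_restrict (W \ G) (G \ W) hnc (x := sᶜ) (y := s) (hsame.symm _ _)).1.1 hs.2
    exact (mem_sdiff.1 this).2 (mem_sdiff.1 hs.1).1
  -- X₂ points (crossing points of (A∩G, B∩G)) are cross-component in Y \ V
  have hCDeq : ((A ∩ G) ∪ (B ∩ G)) \ ((A ∩ G) ∩ (B ∩ G)) = G \ W := by
    ext s
    rw [hW]
    simp only [mem_sdiff, mem_union, mem_inter]
    constructor
    · rintro ⟨h1, h2⟩
      have hsG : s ∈ G := h1.elim (fun h => h.2) (fun h => h.2)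
      exact ⟨hsG, fun hab => h2 ⟨⟨hab.1, hsG⟩, ⟨hab.2, hsG⟩⟩⟩
    · rintro ⟨hsG, h2⟩
      refine ⟨?_, fun h1 => h2 ⟨h1.1.1, h1.2.1⟩⟩
      rcases mem_union.1 (hGAB hsG) with hsA | hsB
      · exact Or.inl ⟨hsA, hsG⟩
      · exact Or.inr ⟨hsB, hsG⟩
  have hC : IsUpperSet ((A ∩ G : Finset (Finset κ)) : Set (Finset κ)) := by rw [coe_inter]; exact hA.inter hG
  have hD : IsUpperSet ((B ∩ G : Finset (Finset κ)) : Set (Finset κ)) := by rw [coe_inter]; exact hB.inter hG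
  have hX2 : ∀ s ∈ ((A ∩ G) \ B) ∩ ((B ∩ G) \ A)ᶜˢ, s ∈ Y \ V ∧ sᶜ ∈ Y \ V ∧ ¬ SameComp (Y \ V) s sᶜ := by
    intro s hs
    rw [mem_inter, mem_compls, mem_sdiff, mem_sdiff, mem_inter, mem_inter] at hs
    obtain ⟨⟨⟨hsA, hsG⟩, hsB⟩, ⟨hcB, hcG⟩, hcA⟩ := hs
    have hsGW : s ∈ G \ W := mem_sdiff.2 ⟨hsG, fun h => hsB (mem_inter.1 h).2⟩
    have hcGW : sᶜ ∈ G \ W := mem_sdiff.2 ⟨hcG, fun h => hcA (mem_inter.1 h).1⟩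
    refine ⟨by rw [hsplit]; exact mem_union.2 (Or.inr hsGW), by rw [hsplit]; exact mem_union.2 (Or.inr hcGW), ?_⟩
    intro hsame
    rw [hsplit] at hsame
    have hres := (sameComp_restrict (W \ G) (G \ W) hnc hsame).2 hsGW
    rw [← hCDeq] at hres
    have := (mem_sdiff_iff_of_sameComp (A ∩ G) (B ∩ G) hC hD hres).1
      (mem_sdiff.2 ⟨mem_inter.2 ⟨hsA, hsG⟩, fun h => hsB (mem_inter.1 h).1⟩)
    exact (mem_sdiff.1 this).2 (mem_inter.2 ⟨hcB, hcG⟩)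
  -- the four families X₁, X₁ᶜˢ, X₂, X₂ᶜˢ are pairwise disjoint; their total weight is ≤ ccWeight ω (Y \ V)
  set X1 : Finset (Finset κ) := (W \ G) ∩ (G \ W)ᶜˢ with hX1d
  set X2 : Finset (Finset κ) := ((A ∩ G) \ B) ∩ ((B ∩ G) \ A)ᶜˢ with hX2d
  set Z : Finset (Finset κ) := (X1 ∪ X1ᶜˢ) ∪ (X2 ∪ X2ᶜˢ) with hZ
  have hZprop : ∀ s ∈ Z, s ∈ Y \ V ∧ sᶜ ∈ Y \ V ∧ ¬ SameComp (Y \ V) s sᶜ := by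
    intro s hs
    have hequiv : Equivalence (SameComp (Y \ V)) := Relation.EqvGen.is_equivalence _
    rcases mem_union.1 hs with h1 | h2
    · rcases mem_union.1 h1 with h | h
      · exact hX1 s h
      · have h' := hX1 sᶜ (mem_compls.1 h)
        rw [compl_compl] at h'
        exact ⟨h'.2.1, h'.1, fun hsame => h'.2.2 (hequiv.symm hsame)⟩
    · rcases mem_union.1 h2 with h | h
      · exact hX2 s h
      · have h' := hX2 sᶜ (mem_compls.1 h)
        rw [compl_compl] at h'
        exact ⟨h'.2.1, h'.1, fun hsame => h'.2.2 (hequiv.symm hsame)⟩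
  have hZle : ∑ s ∈ Z, ω s ≤ ccWeight ω (Y \ V) := by
    unfold ccWeight
    have hZsub : Z ⊆ Y \ V := fun s hs => (hZprop s hs).1
    calc ∑ s ∈ Z, ω s = ∑ s ∈ Z, (if sᶜ ∈ Y \ V ∧ ¬ SameComp (Y \ V) s sᶜ then ω s else 0) :=
          sum_congr rfl fun s hs => by rw [if_pos ⟨(hZprop s hs).2.1, (hZprop s hs).2.2⟩]
      _ ≤ ∑ s ∈ Y \ V, (if sᶜ ∈ Y \ V ∧ ¬ SameComp (Y \ V) s sᶜ then ω s else 0) := by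
          refine sum_le_sum_of_subset_of_nonneg hZsub fun s _ _ => ?_
          split_ifs
          · exact hω₀ s
          · exact le_refl _
  -- disjointness and weights of the four pieces
  have hX1out : ∀ s ∈ X1, s ∉ G := fun s hs => (mem_sdiff.1 (mem_inter.1 hs).1).2
  have hX1cin : ∀ s ∈ X1ᶜˢ, s ∈ G := fun s hs => by
    have := (mem_inter.1 (mem_compls.1 hs)).2; rw [mem_compls, compl_compl] at this; exact (mem_sdiff.1 this).1
  have hX2inA : ∀ s ∈ X2, s ∈ A ∧ s ∈ G ∧ sᶜ ∈ G := fun s hs => by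
    have h := mem_inter.1 hs
    exact ⟨(mem_inter.1 (mem_sdiff.1 h.1).1).1, (mem_inter.1 (mem_sdiff.1 h.1).1).2,
      (mem_inter.1 (mem_sdiff.1 (mem_compls.1 h.2)).1).2⟩
  have hX2cninA : ∀ s ∈ X2ᶜˢ, s ∉ A ∧ s ∈ G ∧ sᶜ ∈ G := fun s hs => by
    have h := mem_inter.1 (mem_compls.1 hs)
    refine ⟨(mem_sdiff.1 (mem_compls.1 h.2)).2 ∘ (fun h' => by rw [compl_compl]; exact h'), ?_, (mem_inter.1 (mem_sdiff.1 h.1).1).2⟩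
    have := (mem_inter.1 (mem_sdiff.1 (mem_compls.1 h.2)).1).2; rwa [compl_compl] at this
  have hd1 : Disjoint X1 X1ᶜˢ := disjoint_left.2 fun s h1 h2 => hX1out s h1 (hX1cin s h2)
  have hd2 : Disjoint X2 X2ᶜˢ := disjoint_left.2 fun s h1 h2 => (hX2cninA s h2).1 (hX2inA s h1).1
  have hd3 : Disjoint (X1 ∪ X1ᶜˢ) (X2 ∪ X2ᶜˢ) := by
    rw [disjoint_left]
    intro s hs1 hs2
    rcases mem_union.1 hs1 with h | h
    · -- s ∉ G but every point of X2 ∪ X2ᶜˢ is in G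
      rcases mem_union.1 hs2 with h' | h'
      · exact hX1out s h (hX2inA s h').2.1
      · exact hX1out s h (hX2cninA s h').2.1
    · -- s ∈ X1ᶜˢ : sᶜ ∈ X1 so sᶜ ∉ G, but points of X2 ∪ X2ᶜˢ have sᶜ ∈ G
      have hsc : sᶜ ∉ G := hX1out sᶜ (mem_compls.1 h)
      rcases mem_union.1 hs2 with h' | h'
      · exact hsc (hX2inA s h').2.2
      · exact hsc (hX2cninA s h').2.2
  have hZsum : ∑ s ∈ Z, ω s = 2 * ∑ s ∈ X1, ω s + 2 * ∑ s ∈ X2, ω s := by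
    rw [hZ, sum_union hd3, sum_union hd1, sum_union hd2, sum_compls_eq ω hsym X1, sum_compls_eq ω hsym X2]
    ring
  have hmid : 0 ≤ ∑ s ∈ (A ∩ B ∩ G) ∩ (G \ (A ∪ B))ᶜˢ, ω s := sum_nonneg fun s _ => hω₀ s
  -- assemble: κ = ω(V \ Yᶜˢ) − ω(X1)
  have hkap' : (∑ s ∈ (A ∩ B) ∩ G, ω s) - ∑ s ∈ (A ∩ B) ∩ Gᶜˢ, ω s = (∑ s ∈ V \ Yᶜˢ, ω s) - ∑ s ∈ X1, ω s := by
    rw [← hW, hkap]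
  rw [hkap']
  linarith [hZle, hZsum, hKCi]

end TwistedAD

end Summit.CriticalPhenomena.PercolationContinuityZ3.Theorems
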